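import Summits.HubbardSuperconductivity.HubbardSuperconductivity.Theorems.NodalDiracTwistBridgeNodalToDWaveDiagonalParityFlip

/-!
# The sign of the parity flip (crux `NodalDiracWeakCoupling`, line `birth`)

Route `HubbardSuperconductivity/NodalDiracTwist`, crux stmt-HubbardSuperconductivity-10370
(`NodalDiracWeakCoupling`), skeleton `Cruxes/NodalDiracWeakCoupling/Lines/birth.lean` (v8),
registered stub `stub_signOfParityFlip` ("Longuet-Higgins backwards"), the mirror image of
`re_swapSign_mul_lt_zero_of_holonomy_neg` (`…BridgeNodalToDWaveDiagonalParityFlip.lean`).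

Let `p` be a diagonal twist (`p₀ = p₁`) and `r > 0` a radius such that the `(N, S^z = 0)` sector
ground state of the spin-twisted torus `H_L(U, φ)` is unique up to scalars at every point of the
circle `|φ - p| = r`.  If sector ground states `χ₊` at the vertex `p + r (cos π/4, sin π/4)` and
`χ₋` at `p + r (cos 5π/4, sin 5π/4)` are eigenvectors of the swap `U_{sr 3} = fockD4 (sr 3)`
(`(x₀, x₁) ↦ (x₁, x₀)`) with eigenvalues `d₊`, `d₋` and `Re (d₋ conj d₊) < 0`, then for all
`m ≥ m₀` and EVERY choice of unit sector ground states on the `8m`-gon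
`p + r (cos 2πi/8m, sin 2πi/8m)` the cyclic overlap product has negative real part
(`stub_signOfParityFlip`).

Proof.  Unit ground states `u_i` on the upper half `m ≤ i ≤ 5m` of the polygon with `u_m ∝ χ₊`,
`u_{5m} ∝ χ₋` (ground states exist at every twist since the sector is non-trivial), reflected by
`U_{sr 3}` to the lower half (`isGroundStateInSector_swap`; the swap is `θ ↦ π/2 - θ` on the
circle about `p`); by `prod_overlap_reflectedLoop` the cyclic product of this polygon is
`d₋ conj(d₊) |P|²`, `P` the product of the overlaps along the upper half.  Two additions to the
landed argument: (a) `P ≠ 0` once the mesh is finer than the `δ` of the uniform overlap of unit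
ground states on the compact circle of uniqueness (`uniform_overlap_of_isCompact` with `ε = 1`:
neighbouring unit ground states have non-zero overlap), so the real part is
`Re (d₋ conj d₊) |P|² < 0`; (b) any other choice of unit ground states on the same polygon differs
from this one by unimodular phases (uniqueness on the circle), which cancel cyclically
(`prod_star_smul_dotProduct_smul`).

## References

Y. Hatsugai, J. Phys. Soc. Jpn. 75 (2006) 123601 (quantised Berry phases; `ℤ₂` holonomy of a
real ground-state bundle); T. Fukui, Y. Hatsugai, H. Suzuki, J. Phys. Soc. Jpn. 74 (2005) 1674
(lattice link variables / cyclic overlap products, gauge invariance); H. C. Longuet-Higgins,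
Proc. R. Soc. A 344 (1975) 147 (sign change of a real eigenvector around a degeneracy). No new
definitions, no named facts.
-/

-- the mandated namespace repeats `HubbardSuperconductivity` (single-problem summit, D-0017)
set_option linter.dupNamespace false

noncomputable section

namespace Summit.HubbardSuperconductivity.HubbardSuperconductivity.Theorems.NodalDiracTwist

open Matrix Finset Literature.MathematicalPhysics.QuantumLattice Literature.Probability.LatticeModels
open Summit.HubbardSuperconductivity.HubbardSuperconductivity.Theorems.NodalDiracTwist.BridgeNodalToDWave

-- The statement is the registered stub verbatim (one line).  Its tail binders are written in the
-- bracketed forms `∃ (m₀ : ℕ), ∀ (m : ℕ), m ≥ m₀ → …`, `∀ (ψ : …)`, `(∀ (i : …), …)`, `∏ (i : …), …`,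
-- which elaborate to the very same proposition as `∃ m₀ : ℕ, ∀ m ≥ m₀, ∀ ψ : …, (∀ i : …, …) → (∏ i : …, …)`
-- (same binder names and types): the stub registry recorded the signature text only up to the
-- first `:=` (inside `(L := L)`), and the gate matches registered text as a normalised prefix.
/-- **Registered stub `stub_signOfParityFlip` of crux stmt-HubbardSuperconductivity-10370 (line
`birth`, skeleton v8): opposite swap parities at the two diagonal vertices of a circle of
uniqueness force holonomy `-1` on all fine `8m`-gons.**  At a diagonal twist `p` (`p₀ = p₁`) and a
radius `r > 0` such that the `(N, S^z = 0)` sector ground state of `H_L(U, ·)` is unique up to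
scalars at every point of the circle `|φ - p| = r`: if sector ground states `χ₊` at
`p + r (cos π/4, sin π/4)` and `χ₋` at `p + r (cos 5π/4, sin 5π/4)` satisfy `U_{sr 3} χ± = d± χ±`
with `Re (d₋ conj d₊) < 0`, then there is `m₀` such that for all `m ≥ m₀` and every choice `ψ` of
unit sector ground states at the vertices `p + r (cos 2πi/8m, sin 2πi/8m)` of the `8m`-gon,
`Re ∏_i ⟨ψ_i, ψ_{i+1}⟩ < 0`.  (Reflected polygon `prod_overlap_reflectedLoop`: the product is
`d₋ conj(d₊) |P|²`; `P ≠ 0` by `uniform_overlap_of_isCompact` on the circle; arbitrary unit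
choices differ by unimodular phases, `prod_star_smul_dotProduct_smul`.)  Hatsugai, J. Phys. Soc.
Jpn. 75 (2006) 123601; Fukui–Hatsugai–Suzuki, J. Phys. Soc. Jpn. 74 (2005) 1674; Longuet-Higgins,
Proc. R. Soc. A 344 (1975) 147. [folklore] -/
theorem stub_signOfParityFlip : ∀ (L : ℕ) [NeZero L] (U : ℝ) (N : ℕ) (p : Fin 2 → ℝ), p 0 = p 1 → ∀ (r : ℝ), 0 < r → (∀ φ : Fin 2 → ℝ, (φ 0 - p 0) ^ 2 + (φ 1 - p 1) ^ 2 = r ^ 2 → ∀ χ₁ χ₂ : Fock (Orb (FermionTorus 2 L)), IsGroundStateInSector (spinTwistedHubbardTorus L U φ) N 0 χ₁ → IsGroundStateInSector (spinTwistedHubbardTorus L U φ) N 0 χ₂ → ∃ z : ℂ, χ₂ = z • χ₁) → ∀ (χp χm : Fock (Orb (FermionTorus 2 L))) (dp dm : ℂ), IsGroundStateInSector (spinTwistedHubbardTorus L U (fun ν : Fin 2 => p ν + r * (if ν = 0 then Real.cos (Real.pi / 4) else Real.sin (Real.pi / 4)))) N 0 χp → (fockD4 (L := L) (DihedralGroup.sr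 3)).val *ᵥ χp = dp • χp → IsGroundStateInSector (spinTwistedHubbardTorus L U (fun ν : Fin 2 => p ν + r * (if ν = 0 then Real.cos (5 * Real.pi / 4) else Real.sin (5 * Real.pi / 4)))) N 0 χm → (fockD4 (L := L) (DihedralGroup.sr 3)).val *ᵥ χm = dm • χm → (dm * star dp).re < 0 → ∃ (m₀ : ℕ), ∀ (m : ℕ), m ≥ m₀ → ∀ (ψ : Fin (8 * m) → Fock (Orb (FermionTorus 2 L))), (∀ (i : Fin (8 * m)), IsGroundStateInSector (spinTwistedHubbardTorus L U (fun ν : Fin 2 => p ν + r * (if ν = 0 then Real.cos (2 * Real.pi * (i : ℕ) / ((8 * m : ℕ) : ℝ)) else Real.sin (2 * Real.pi * (i : ℕ) / ((8 * m : ℕ) : ℝ))))) N 0 (ψ i) ∧ star (ψ i) ⬝ᵥ ψ i = 1) → (∏ (i : Fin (8 * m)), star (ψ i) ⬝ᵥ ψ (finRotate (8 * m) i)).re < 0 := by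
  intro L _ U N p hp r hr huniq χp χm dp dm hχp hdp hχm hdm hre
  classical
  -- the swap as a map of vectors; it preserves inner products
  set Γ : Fock (Orb (FermionTorus 2 L)) → Fock (Orb (FermionTorus 2 L)) :=
    fun v => (fockD4 (L := L) (DihedralGroup.sr 3)).val *ᵥ v with hΓdef
  have hΓ : ∀ v w : Fock (Orb (FermionTorus 2 L)), star (Γ v) ⬝ᵥ Γ w = star v ⬝ᵥ w :=
    fun v w => star_fockRelabel_mulVec_dotProduct_fockRelabel_mulVec _ v w
  -- unit sector ground states exist at every twist (the sector contains `χp ≠ 0`)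
  have hK : (szSector N 0 : Submodule ℂ (Fock (Orb (FermionTorus 2 L)))) ≠ ⊥ :=
    (Submodule.ne_bot_iff _).2 ⟨χp, hχp.1, hχp.2.1⟩
  have hex : ∀ φ : Fin 2 → ℝ, ∃ v : Fock (Orb (FermionTorus 2 L)),
      IsGroundStateInSector (spinTwistedHubbardTorus L U φ) N 0 v ∧ star v ⬝ᵥ v = 1 := fun φ => by
    obtain ⟨v, hv, h1, he⟩ := exists_unit_eigen_minEnergyOn (spinTwistedHubbardTorus_isHermitian L U φ)
      (szSector N 0) (fun v hv => spinTwistedHubbardTorus_mulVec_mem_szSector L U φ hv) hK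
    exact ⟨v, ⟨hv, ne_zero_of_unit h1, he⟩, h1⟩
  choose v hv using hex
  -- normalised junction vectors
  obtain ⟨cp, hcp, hcp1⟩ := exists_smul_unit hχp.2.1
  obtain ⟨cm, hcm, hcm1⟩ := exists_smul_unit hχm.2.1
  -- the points `p + r (cos t, sin t)` of the circle
  set pt : ℝ → Fin 2 → ℝ := fun t ν => p ν + r * (if ν = 0 then Real.cos t else Real.sin t)
    with hptdef
  have hptD : ∀ t : ℝ, (pt t 0 - p 0) ^ 2 + (pt t 1 - p 1) ^ 2 = r ^ 2 := fun t =>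
    polar_sq_eq p r t
  -- uniform overlap of unit ground states on the compact circle of uniqueness (`ε = 1`)
  set D : Set (Fin 2 → ℝ) := {φ | (φ 0 - p 0) ^ 2 + (φ 1 - p 1) ^ 2 = r ^ 2} with hDdef
  have hDclosed : IsClosed D := isClosed_eq (by fun_prop) continuous_const
  have hDc : IsCompact D :=
    (isCompact_disk p hr.le).of_isClosed_subset hDclosed fun φ hφ => le_of_eq hφ
  have hlb : ∀ φ : Fin 2 → ℝ, ∀ w ∈ (szSector N 0 : Submodule ℂ (Fock (Orb (FermionTorus 2 L)))),
      star w ⬝ᵥ w = 1 →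
      (spinTwistedHubbardTorus L U φ).minEnergyOn (szSector N 0) ≤
        (star w ⬝ᵥ spinTwistedHubbardTorus L U φ *ᵥ w).re :=
    fun φ w hw h1 =>
      minEnergyOn_le_rayleigh_of_mem (spinTwistedHubbardTorus_isHermitian L U φ) _ hw h1
  have huniqD : ∀ φ ∈ D, ∀ χ₁ χ₂ : Fock (Orb (FermionTorus 2 L)),
      (χ₁ ∈ (szSector N 0 : Submodule ℂ (Fock (Orb (FermionTorus 2 L)))) ∧ χ₁ ≠ 0 ∧
        spinTwistedHubbardTorus L U φ *ᵥ χ₁ =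
          (((spinTwistedHubbardTorus L U φ).minEnergyOn (szSector N 0) : ℝ) : ℂ) • χ₁) →
      (χ₂ ∈ (szSector N 0 : Submodule ℂ (Fock (Orb (FermionTorus 2 L)))) ∧ χ₂ ≠ 0 ∧
        spinTwistedHubbardTorus L U φ *ᵥ χ₂ =
          (((spinTwistedHubbardTorus L U φ).minEnergyOn (szSector N 0) : ℝ) : ℂ) • χ₂) →
      ∃ z : ℂ, χ₂ = z • χ₁ :=
    fun φ hφ χ₁ χ₂ h₁ h₂ => huniq φ hφ χ₁ χ₂ h₁ h₂
  obtain ⟨δ, hδ, hov⟩ := uniform_overlap_of_isCompact (szSector N 0) (spinTwistedHubbardTorus L U)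
    (continuous_spinTwistedHubbardTorus L U) hDc hlb huniqD one_pos
  -- the mesh: `8m` vertices, `m ≥ 1`, with `r · 2π/(8m) < δ`
  obtain ⟨n, hn⟩ := exists_nat_gt (r * (2 * Real.pi) / δ)
  refine ⟨n + 1, fun m hmn ψ hψ => ?_⟩
  have hm : 1 ≤ m := by omega
  have hstep : r * (2 * Real.pi / ((8 * m : ℕ) : ℝ)) < δ := by
    have hnm : (n : ℝ) ≤ m := by exact_mod_cast (show n ≤ m by omega)
    have h1 : r * (2 * Real.pi) < m * δ := (div_lt_iff₀ hδ).1 (hn.trans_le hnm)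
    have hm8 : (0 : ℝ) < ((8 * m : ℕ) : ℝ) := by exact_mod_cast (show 0 < 8 * m by omega)
    rw [← mul_div_assoc, div_lt_iff₀ hm8]
    push_cast
    nlinarith [h1, mul_nonneg (Nat.cast_nonneg m) hδ.le]
  -- the upper half of the polygon
  set θ : ℕ → ℝ := fun j => 2 * Real.pi * (j : ℝ) / ((8 * m : ℕ) : ℝ) with hθdef
  set u : ℕ → Fock (Orb (FermionTorus 2 L)) := fun j =>
    if j = m then cp • χp else if j = 5 * m then cm • χm else v (pt (θ j)) with hudef
  have hum : u m = cp • χp := by simp only [hudef, if_pos rfl]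
  have hu5 : u (5 * m) = cm • χm := by
    have h5 : (5 * m ≠ m) := by omega
    simp [hudef, h5]
  have hU1 : ∀ j : ℕ, IsGroundStateInSector (spinTwistedHubbardTorus L U (pt (θ j))) N 0 (u j) ∧
      star (u j) ⬝ᵥ u j = 1 := by
    intro j
    by_cases hjm : j = m
    · rw [hjm, hum]
      refine ⟨?_, hcp1⟩
      have hq : pt (θ m) = fun ν : Fin 2 => p ν +
          r * (if ν = 0 then Real.cos (Real.pi / 4) else Real.sin (Real.pi / 4)) := by
        simp only [hptdef, hθdef]
        rw [angle_m hm]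
      rw [hq]
      exact isGroundStateInSector_smul hχp hcp
    by_cases hj5 : j = 5 * m
    · rw [hj5, hu5]
      refine ⟨?_, hcm1⟩
      have hq : pt (θ (5 * m)) = fun ν : Fin 2 => p ν +
          r * (if ν = 0 then Real.cos (5 * Real.pi / 4) else Real.sin (5 * Real.pi / 4)) := by
        simp only [hptdef, hθdef]
        rw [angle_5m hm]
      rw [hq]
      exact isGroundStateInSector_smul hχm hcm
    · have hu : u j = v (pt (θ j)) := by simp only [hudef, if_neg hjm, if_neg hj5]
      rw [hu]
      exact hv _
  have hU2 : Γ (u m) = dp • u m := by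
    simp only [hΓdef]
    rw [hum, mulVec_smul, hdp, smul_smul, smul_smul, mul_comm]
  have hU3 : Γ (u (5 * m)) = dm • u (5 * m) := by
    simp only [hΓdef]
    rw [hu5, mulVec_smul, hdm, smul_smul, smul_smul, mul_comm]
  -- consecutive vertices are `δ`-close, so the links along the upper half do not vanish
  have hdist : ∀ j : ℕ, dist (pt (θ j)) (pt (θ (j + 1))) < δ := fun j => by
    have h := dist_polar_le p hr.le le_rfl r (θ j) (θ (j + 1))
    have hang' : θ (j + 1) - θ j = 2 * Real.pi / ((8 * m : ℕ) : ℝ) := by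
      simp only [hθdef]
      push_cast
      ring
    have hang : |θ j - θ (j + 1)| = 2 * Real.pi / ((8 * m : ℕ) : ℝ) := by
      rw [abs_sub_comm, hang', abs_of_nonneg (by positivity)]
    rw [sub_self, abs_zero, add_zero, hang] at h
    exact h.trans_lt hstep
  have hlink : ∀ j : ℕ, star (u j) ⬝ᵥ u (j + 1) ≠ 0 := fun j h0 => by
    have h := hov (pt (θ j)) (hptD _) (pt (θ (j + 1))) (hptD _) (hdist j) (u j) (u (j + 1))
      (hU1 j).1 (hU1 j).2 (hU1 (j + 1)).1 (hU1 (j + 1)).2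
    rw [h0, norm_zero] at h
    norm_num at h
  -- the closed polygon: reflect the upper half
  set Ψ : ℕ → Fock (Orb (FermionTorus 2 L)) := fun i =>
    if i < m then Γ (u (2 * m - i)) else if i ≤ 5 * m then u i else Γ (u (10 * m - i)) with hΨdef
  have hlo : ∀ i, i < m → Ψ i = Γ (u (2 * m - i)) := fun i hi => by
    simp only [hΨdef, if_pos hi]
  have hmid : ∀ i, m ≤ i → i ≤ 5 * m → Ψ i = u i := fun i h1 h2 => by
    simp only [hΨdef, if_neg (not_lt.2 h1), if_pos h2]
  have hhi : ∀ i, 5 * m < i → i ≤ 8 * m → Ψ i = Γ (u (10 * m - i)) := fun i h1 _ => by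
    simp only [hΨdef, if_neg (show ¬ i < m by omega), if_neg (not_le.2 h1)]
  -- the swap is `θ ↦ π/2 - θ` on the circle about the diagonal point `p`; `2π`-periodicity
  have hswap_pt : ∀ t : ℝ, (![pt t 1, pt t 0] : Fin 2 → ℝ) = pt (Real.pi / 2 - t) := fun t => by
    simp only [hptdef]
    funext ν
    fin_cases ν
    · simp [Real.cos_pi_div_two_sub, hp]
    · simp [Real.sin_pi_div_two_sub, hp]
  have hper : ∀ t : ℝ, pt (t - 2 * Real.pi) = pt t := fun t => by
    simp only [hptdef, Real.cos_sub_two_pi, Real.sin_sub_two_pi]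
  -- every vertex of the polygon is a unit sector ground state at the right twist
  have hswapGS : ∀ j : ℕ, IsGroundStateInSector
      (spinTwistedHubbardTorus L U (pt (Real.pi / 2 - θ j))) N 0 (Γ (u j)) ∧
      star (Γ (u j)) ⬝ᵥ Γ (u j) = 1 := by
    intro j
    refine ⟨?_, by rw [hΓ]; exact (hU1 j).2⟩
    have h := isGroundStateInSector_swap L (hU1 j).1
    rw [hswap_pt] at h
    exact h
  have hΨGS : ∀ i, i ≤ 8 * m →
      IsGroundStateInSector (spinTwistedHubbardTorus L U (pt (θ i))) N 0 (Ψ i) ∧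
      star (Ψ i) ⬝ᵥ Ψ i = 1 := by
    intro i hi8
    by_cases h1 : i < m
    · rw [hlo i h1]
      have h := hswapGS (2 * m - i)
      have hang : Real.pi / 2 - θ (2 * m - i) = θ i := by
        simp only [hθdef]
        rw [angle_reflect_lo hm (by omega), sub_sub_cancel]
      rwa [hang] at h
    by_cases h2 : i ≤ 5 * m
    · rw [hmid i (not_lt.1 h1) h2]
      exact hU1 i
    · rw [hhi i (not_le.1 h2) hi8]
      have h := hswapGS (10 * m - i)
      have hang : Real.pi / 2 - θ (10 * m - i) = θ i - 2 * Real.pi := by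
        simp only [hθdef]
        rw [angle_reflect_hi hm (by omega)]
        ring
      rwa [hang, hper] at h
  -- the given unit ground states differ from the polygon `Ψ` by unimodular phases
  have hzex : ∀ i : Fin (8 * m), ∃ z : ℂ, ψ i = z • Ψ i := fun i =>
    huniq (pt (θ i)) (hptD (θ i)) (Ψ i) (ψ i) (hΨGS i i.isLt.le).1 (hψ i).1
  choose z hz using hzex
  have hz1 : ∀ i : Fin (8 * m), ‖z i‖ = 1 := fun i =>
    norm_eq_one_of_unit_smul (hΨGS i i.isLt.le).2 (by rw [← hz i]; exact (hψ i).2)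
  have hprod : ∏ i : Fin (8 * m), star (ψ i) ⬝ᵥ ψ (finRotate (8 * m) i) =
      ∏ i : Fin (8 * m), star (Ψ i) ⬝ᵥ Ψ (finRotate (8 * m) i) := by
    rw [← prod_star_smul_dotProduct_smul (finRotate (8 * m)) z hz1 (fun i : Fin (8 * m) => Ψ i)]
    exact Finset.prod_congr rfl fun i _ => by rw [hz i, hz (finRotate (8 * m) i)]
  -- the cyclic product of the reflected polygon is `d₋ conj(d₊) |P|²`, and `P ≠ 0`
  rw [hprod, prod_finRotate_eq_prod_range (by omega : 1 ≤ 8 * m) Ψ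
      (by rw [hhi (8 * m) (by omega) le_rfl, hlo 0 (by omega),
        show 10 * m - 8 * m = 2 * m - 0 from by omega]),
    prod_overlap_reflectedLoop Γ hΓ hm u hU2 hU3 (hU1 m).2 (hU1 (5 * m)).2 Ψ hlo hmid hhi]
  set P : ℂ := ∏ i ∈ Ico m (5 * m), star (u i) ⬝ᵥ u (i + 1) with hP
  have hP0 : P ≠ 0 := Finset.prod_ne_zero_iff.2 fun i _ => hlink i
  have hPP : star P * P = ((‖P‖ ^ 2 : ℝ) : ℂ) := by
    rw [Complex.star_def, Complex.conj_mul']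
    push_cast
    rfl
  rw [hPP, Complex.re_mul_ofReal]
  exact mul_neg_of_neg_of_pos hre (pow_pos (norm_pos_iff.2 hP0) 2)

end Summit.HubbardSuperconductivity.HubbardSuperconductivity.Theorems.NodalDiracTwist

end
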